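import Summits.QuantumAdvantage.QuantumAdvantage.Theorems.CharDialDisjPencilB

/-! # CharDialDisjPencilC — part 3/4 (mechanical split for landing of `CharDialDisjPencil`; content verbatim; scopes re-opened with their variables) -/

noncomputable section
open Finset
open Summit.QuantumAdvantage.AdviceFreeQNC0 Summit.QuantumAdvantage.AdviceFreeQNC0.JLinPeel

namespace Summit.QuantumAdvantage.AdviceFreeQNC0.JLinPeel
open AffBells22 AffBells23 Subcube

section DisjointPencilD
variable (p : ℕ) [Fact p.Prime] {n : ℕ}

/-- **DISJOINT PENCILS, tables (`W = ∅`)**: for `p ≥ 5` there are `θ < 1`, `E`, `n₀` such that for `n ≥ n₀` and every `G` with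
`E·n·(log₂ n)⁵ ≤ G²`, every dial of `log₂ n`-junta tables over directions `V_1 … V_R` with pairwise disjoint supports of size
`≥ G` loses — NO bound on `R` (any `R ≤ n/G`). -/
theorem disjPencil_hard (hp : 5 ≤ p) : ∃ θ : ℝ, θ < 1 ∧ ∃ E n₀ : ℕ, ∀ n ≥ n₀, ∀ (R G : ℕ),
    E * n * (Nat.log 2 n) ^ 5 ≤ G ^ 2 → ∀ (c : ℕ) (V : Fin R → Fin n → ZMod p)
      (Y : (Fin R → ZMod p) → Fin (n + 1) → (Fin n → Bool) → Bool),
      (∀ s g, ∃ J : Finset (Fin n), J.card ≤ Nat.log 2 n ∧ ∀ u v : Fin n → Bool, (∀ i ∈ J, u i = v i) →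
        Y s g u = Y s g v) →
      (∀ j j', j ≠ j' → ∀ i, V j i = 0 ∨ V j' i = 0) →
      (∀ j, G ≤ (univ.filter fun i : Fin n => V j i ≠ 0).card) →
      ((univ.filter fun u : Fin n → Bool => ringWinU c (WindowCounter.formStratR p V Y) u = true).card : ℝ) ≤
        θ * 2 ^ n := by
  obtain ⟨θ, hθ, E, n₀, h⟩ := disj_denseD p hp
  refine ⟨θ, hθ, E, n₀, fun n hn R G hE c V Y hY hdisj hsupp => ?_⟩
  have := h n hn R G hE ∅ (fun _ => false) c V Y (by simp) hY hdisj (fun j => by simpa using hsupp j)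
  simpa [SubcubeBells.merge_empty] using this

/-- **DISJOINT PENCILS, data level**: `log₂ n`-junta ⊕ form data whose non-blind cuts' forms lie in the span of directions
`V_1 … V_R` with pairwise disjoint supports each of size `≥ G`, `E·n·(log₂ n)⁵ ≤ G²`, lose — every prime `p ≥ 5`, ONE `θ`,
no rank hypothesis. -/
theorem disjPencil_hard_unif (hp : 5 ≤ p) : ∃ θ : ℝ, θ < 1 ∧ ∃ E n₀ : ℕ, ∀ n ≥ n₀, ∀ (R G : ℕ),
    E * n * (Nat.log 2 n) ^ 5 ≤ G ^ 2 → ∀ (c : ℕ) (D : JLinData p n), (∀ g, (D.J g).card ≤ Nat.log 2 n) →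
      (∃ V : Fin R → Fin n → ZMod p,
        (∀ j j', j ≠ j' → ∀ i, V j i = 0 ∨ V j' i = 0) ∧ (∀ j, G ≤ (univ.filter fun i : Fin n => V j i ≠ 0).card) ∧
        ∀ g, ¬ (∀ u s s', D.h g u s = D.h g u s') → ∃ l : Fin R → ZMod p, D.a g = fun i => ∑ j, l j * V j i) →
      (winCount c D.strat : ℝ) ≤ θ * (2 : ℝ) ^ n := by
  obtain ⟨θ, hθ, E, n₀, h⟩ := disjPencil_hard p hp
  refine ⟨θ, hθ, E, n₀, fun n hn R G hE c D hJ hV => ?_⟩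
  obtain ⟨V, hdisj, hsupp, hA⟩ := hV
  obtain ⟨Y, hY, hstrat⟩ := strat_eq_formStratR D V hA
  rw [hstrat]
  exact h n hn R G hE c V Y (fun s g => ⟨D.J g, hJ g, fun u v huv => hY s g u v huv⟩) hdisj hsupp

/-- **re-presenting a pencil ON A SUBCUBE**: if every non-blind cut's form agrees OFF `W` with `Σ_j l_{g,j} V_j`, then on the
subcube `{merge_W β u}` the strategy is the dial over `V` of the junta tables
`Y_s(g,u) = h_g(u, c_g(β) + Σ_j l_{g,j}(s_j − d_j(β)))` (`c_g(β)`, `d_j(β)` the `W`-parts of the forms at `β`). -/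
theorem strat_eq_formStratR_on (D : JLinData p n) (W : Finset (Fin n)) (β : Fin n → Bool) {R : ℕ}
    (V : Fin R → Fin n → ZMod p)
    (hA : ∀ g, ¬ (∀ u s s', D.h g u s = D.h g u s') → ∃ l : Fin R → ZMod p, ∀ i, i ∉ W → D.a g i = ∑ j, l j * V j i) :
    ∃ Y : (Fin R → ZMod p) → Fin (n + 1) → (Fin n → Bool) → Bool,
      (∀ s g (u v : Fin n → Bool), (∀ i ∈ D.J g, u i = v i) → Y s g u = Y s g v) ∧
      ∀ g u, D.strat g (subcubeMerge W β u) = WindowCounter.formStratR p V Y g (subcubeMerge W β u) := by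
  classical
  have hl : ∀ g, ∃ l : Fin R → ZMod p, ¬ (∀ u s s', D.h g u s = D.h g u s') →
      ∀ i, i ∉ W → D.a g i = ∑ j, l j * V j i := fun g => by
    by_cases hb : ∀ u s s', D.h g u s = D.h g u s'
    · exact ⟨0, fun h => (h hb).elim⟩
    · obtain ⟨l, hl⟩ := hA g hb
      exact ⟨l, fun _ => hl⟩
  choose l hl using hl
  refine ⟨fun s g u => D.h g u ((∑ i ∈ W, if β i = true then D.a g i else 0) +
      ∑ j, l g j * (s j - ∑ i ∈ W, if β i = true then V j i else 0)), fun s g u v huv => D.hJ g u v huv _, fun g u => ?_⟩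
  rw [merge_eq_ext_res]
  set v := res W u with hv
  show D.h g (ext W β v) (D.form g (ext W β v)) = D.h g (ext W β v) ((∑ i ∈ W, if β i = true then D.a g i else 0) +
    ∑ j, l g j * (WindowCounter.vecF p V (ext W β v) j - ∑ i ∈ W, if β i = true then V j i else 0))
  by_cases hb : ∀ u s s', D.h g u s = D.h g u s'
  · exact hb _ _ _
  · congr 1
    have e1 : D.form g (ext W β v) = WindowCounter.linF p (D.a g) (ext W β v) := rfl
    rw [e1, linF_ext]
    congr 1
    have e2 : res W (D.a g) = WindowCounter.comb p (l g) (fun j => res W (V j)) := by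
      funext i
      show D.a g (emb W i) = ∑ j, l g j * V j (emb W i)
      exact hl g hb _ (emb_not_mem W i)
    rw [e2, WindowCounter.linF_comb]
    refine sum_congr rfl fun j _ => ?_
    rw [show WindowCounter.vecF p V (ext W β v) j = WindowCounter.linF p (V j) (ext W β v) from rfl, linF_ext]
    ring

/-- **DISJOINT PENCILS ON SUBCUBES, data level**: `2|W| ≤ n`, `E·n·(log₂ n)⁵ ≤ G²`; `log₂ n`-junta ⊕ form data whose non-blind
cuts' forms agree OFF `W` with combinations of directions `V_1 … V_R` with pairwise disjoint supports each having `≥ G`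
nonzero coefficients off `W` win on at most `θ·2ⁿ` inputs `u` counted through `merge_W β u` — every `p ≥ 5`, ONE `θ`. -/
theorem disjPencil_sub_unif (hp : 5 ≤ p) : ∃ θ : ℝ, θ < 1 ∧ ∃ E n₀ : ℕ, ∀ n ≥ n₀, ∀ (R G : ℕ),
    E * n * (Nat.log 2 n) ^ 5 ≤ G ^ 2 → ∀ (W : Finset (Fin n)) (β : Fin n → Bool) (c : ℕ) (D : JLinData p n),
      2 * W.card ≤ n → (∀ g, (D.J g).card ≤ Nat.log 2 n) →
      (∃ V : Fin R → Fin n → ZMod p,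
        (∀ j j', j ≠ j' → ∀ i, V j i = 0 ∨ V j' i = 0) ∧
        (∀ j, G ≤ (univ.filter fun i : Fin n => i ∉ W ∧ V j i ≠ 0).card) ∧
        ∀ g, ¬ (∀ u s s', D.h g u s = D.h g u s') → ∃ l : Fin R → ZMod p, ∀ i, i ∉ W → D.a g i = ∑ j, l j * V j i) →
      ((univ.filter fun u : Fin n → Bool => ringWinU c D.strat (subcubeMerge W β u) = true).card : ℝ) ≤
        θ * (2 : ℝ) ^ n := by
  obtain ⟨θ, hθ, E, n₀, h⟩ := disj_denseD p hp
  refine ⟨θ, hθ, E, n₀, fun n hn R G hE W β c D hW hJ hV => ?_⟩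
  obtain ⟨V, hdisj, hsupp, hA⟩ := hV
  obtain ⟨Y, hY, hstrat⟩ := strat_eq_formStratR_on p D W β V hA
  have e : (univ.filter fun u : Fin n → Bool => ringWinU c D.strat (subcubeMerge W β u) = true) =
      univ.filter fun u : Fin n → Bool =>
        ringWinU c (WindowCounter.formStratR p V Y) (subcubeMerge W β u) = true := by
    refine filter_congr fun u _ => ?_
    have hfun : ∀ g, D.strat g (subcubeMerge W β u) = WindowCounter.formStratR p V Y g (subcubeMerge W β u) :=
      fun g => hstrat g u
    unfold ringWinU
    simp_rw [hfun]
  rw [e]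
  exact h n hn R G hE W β c V Y hW (fun s g => ⟨D.J g, hJ g, fun u v huv => hY s g u v huv⟩) hdisj hsupp

end DisjointPencilD

end Summit.QuantumAdvantage.AdviceFreeQNC0.JLinPeel

namespace Summit.QuantumAdvantage.AdviceFreeQNC0.JLinPeel

open AffBells22 AffBells23 Subcube

/-! ### §29c Prefix counters: rank classes, gaps, pruning, and the two prefix corollaries -/

section PrefixGaps

variable {n : ℕ}

/-- `#{l : Fin m | l < j} = j`. -/
theorem card_fin_filter_lt {m : ℕ} (j : Fin m) : (univ.filter fun l : Fin m => l < j).card = (j : ℕ) := by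
  have e2 : ((univ.filter fun l : Fin m => l < j).map Fin.valEmbedding) = range (j : ℕ) := by
    ext k
    simp only [mem_map, mem_filter, mem_univ, true_and, Fin.valEmbedding_apply, mem_range]
    constructor
    · rintro ⟨l, hl, rfl⟩; exact hl
    · intro hk; exact ⟨⟨k, lt_trans hk j.isLt⟩, hk, rfl⟩
  rw [← card_map Fin.valEmbedding, e2, card_range]

/-- `#{l : Fin m | l ≤ j} = j + 1`. -/
theorem card_fin_filter_le {m : ℕ} (j : Fin m) : (univ.filter fun l : Fin m => l ≤ j).card = (j : ℕ) + 1 := by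
  have e2 : ((univ.filter fun l : Fin m => l ≤ j).map Fin.valEmbedding) = range ((j : ℕ) + 1) := by
    ext k
    simp only [mem_map, mem_filter, mem_univ, true_and, Fin.valEmbedding_apply, mem_range]
    constructor
    · rintro ⟨l, hl, rfl⟩; exact Nat.lt_succ_of_le hl
    · intro hk; exact ⟨⟨k, by omega⟩, Fin.le_def.2 (by show k ≤ j.val; omega), rfl⟩
  rw [← card_map Fin.valEmbedding, e2, card_range]

/-- summing over a finite set = summing over its increasing enumeration. -/
theorem sum_enum {α M : Type*} [LinearOrder α] [AddCommMonoid M] (T : Finset α) {m : ℕ} (h : T.card = m)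
    (φ : α → M) : ∑ j ∈ T, φ j = ∑ k : Fin m, φ (T.orderEmbOfFin h k) := by
  have e : T = (univ : Finset (Fin m)).map (T.orderEmbOfFin h).toEmbedding := by
    ext x
    simp only [mem_map, mem_univ, true_and, RelEmbedding.coe_toEmbedding]
    constructor
    · intro hx
      obtain ⟨l, rfl⟩ : x ∈ Set.range (T.orderEmbOfFin h) := by rw [Finset.range_orderEmbOfFin]; exact hx
      exact ⟨l, rfl⟩
    · rintro ⟨l, rfl⟩; exact Finset.orderEmbOfFin_mem _ _ _
  conv_lhs => rw [e]
  rw [sum_map]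
  rfl

/-- enumeration count (folklore): the `j`-th smallest element of `t` has exactly `j` elements of `t` strictly below it. -/
theorem card_filter_lt_enum {α : Type*} [LinearOrder α] (t : Finset α) {m : ℕ} (h : t.card = m) (j : Fin m) :
    (t.filter (· < t.orderEmbOfFin h j)).card = (j : ℕ) := by
  classical
  have e1 : t.filter (· < t.orderEmbOfFin h j) =
      (univ.filter fun l : Fin m => l < j).map (t.orderEmbOfFin h).toEmbedding := by
    ext x
    simp only [Finset.mem_filter, Finset.mem_map, Finset.mem_univ, true_and, RelEmbedding.coe_toEmbedding]
    constructor
    · rintro ⟨hx, hlt⟩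
      obtain ⟨l, rfl⟩ : x ∈ Set.range (t.orderEmbOfFin h) := by rw [Finset.range_orderEmbOfFin]; exact hx
      exact ⟨l, (t.orderEmbOfFin h).lt_iff_lt.1 hlt, rfl⟩
    · rintro ⟨l, hl, rfl⟩
      exact ⟨Finset.orderEmbOfFin_mem _ _ _, (t.orderEmbOfFin h).lt_iff_lt.2 hl⟩
  rw [e1, card_map, card_fin_filter_lt]

/-- the RANK of a position w.r.t. a set `S` of cuts: the number of cuts of `S` at or below it. -/
def cutRank (S : Finset (Fin (n + 1))) (i : Fin n) : ℕ := (S.filter fun g => g.val ≤ i.val).card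

/-- the lower end of the `j`-th gap of `S` (`0` for `j = 0`, else the `(j−1)`-th cut). -/
def gapLo (S : Finset (Fin (n + 1))) {R : ℕ} (hR : S.card = R) (j : Fin R) : ℕ :=
  if h : j.val = 0 then 0 else (S.orderEmbOfFin hR ⟨j.val - 1, by omega⟩).val

/-- **rank classes are the gaps**: `cutRank_S(i) = j ⟺ gapLo_j ≤ i < (j-th cut)`. -/
theorem cutRank_eq_iff (S : Finset (Fin (n + 1))) {R : ℕ} (hR : S.card = R) (j : Fin R) (i : Fin n) :
    cutRank S i = j.val ↔ gapLo S hR j ≤ i.val ∧ i.val < (S.orderEmbOfFin hR j).val := by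
  classical
  set e := S.orderEmbOfFin hR with he
  have heS : ∀ l, e l ∈ S := fun l => Finset.orderEmbOfFin_mem S hR l
  constructor
  · intro hrk
    constructor
    · by_cases hj : j.val = 0
      · rw [gapLo, dif_pos hj]; exact Nat.zero_le _
      · rw [gapLo, dif_neg hj]
        by_contra hlt
        push Not at hlt
        have hsub : S.filter (fun g => g.val ≤ i.val) ⊆ S.filter (· < e ⟨j.val - 1, by omega⟩) := fun g hg => by
          rw [mem_filter] at hg ⊢
          exact ⟨hg.1, Fin.lt_def.2 (lt_of_le_of_lt hg.2 hlt)⟩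
        have h1 := card_le_card hsub
        rw [he, card_filter_lt_enum] at h1
        change cutRank S i ≤ j.val - 1 at h1
        omega
    · by_contra hle
      push Not at hle
      have hsub : (univ.filter fun l : Fin R => l ≤ j).map e.toEmbedding ⊆ S.filter (fun g => g.val ≤ i.val) := by
        intro g hg
        rw [mem_map] at hg
        obtain ⟨l, hl, rfl⟩ := hg
        rw [mem_filter]
        refine ⟨heS l, le_trans (Fin.le_def.1 (e.monotone (mem_filter.1 hl).2)) hle⟩
      have h1 := card_le_card hsub
      rw [card_map, card_fin_filter_le] at h1
      change j.val + 1 ≤ cutRank S i at h1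
      omega
  · rintro ⟨hloi, hie⟩
    have hset : S.filter (fun g => g.val ≤ i.val) = S.filter (· < e j) := by
      ext g
      simp only [mem_filter, and_congr_right_iff]
      intro hg
      constructor
      · intro hgi; exact Fin.lt_def.2 (lt_of_le_of_lt hgi hie)
      · intro hlt
        obtain ⟨l, rfl⟩ : g ∈ Set.range e := by rw [he, Finset.range_orderEmbOfFin]; exact hg
        have hl : l < j := e.lt_iff_lt.1 hlt
        by_cases hj : j.val = 0
        · exact absurd (Fin.lt_def.1 hl) (by omega)
        · have hl' : l ≤ ⟨j.val - 1, by omega⟩ := Fin.le_def.2 (by show l.val ≤ j.val - 1; have := Fin.lt_def.1 hl; omega)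
          have hmono := Fin.le_def.1 (e.monotone hl')
          rw [gapLo, dif_neg hj] at hloi
          exact le_trans hmono hloi
    show (S.filter fun g => g.val ≤ i.val).card = j.val
    rw [hset, he, card_filter_lt_enum]


end PrefixGaps
end Summit.QuantumAdvantage.AdviceFreeQNC0.JLinPeel
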